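import Summits.QuantumFields.YangMills.Theorems.BalabanUVNodesK0Stub1MultiplierLetterP
import Summits.QuantumFields.YangMills.Theorems.BalabanUVNodesK0FlatPortKernelRowsP
import HarnessLib

/-!
# K0⁷ STUB 1 (`stub_prop8StepCoP13`), sub-target S4b — **THE TWO (46) ROWS OF THE ♭-RESCALED FLAT RIGHT INVERSE `H♭ = H_V∘((Lʲη)⁻¹•·)` ON MATRIX DATA, IN THE S4b
# CAPSTONE's ∕ SOCKET's `hHB`, `hHgrad` SHAPES** — for every `H` with the kernel `(H X)(b) = Σ_t (ν_t·(flatH e_t)(b))•X_t`, `|ν_t| ≤ (L^{j(t)}η)⁻¹` (`ν ≡ 1`: p598821's `H_V`;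
# `ν_t = (L^{j(t)}η)⁻¹`: a right inverse of print's `(Lʲη)•Q_V` = the ♭ chart's `Qlin♭`): `w 1 b·‖H X b‖ ≤ B♭·t` and `w 2 b·Lᵏ·‖H X (b+ν) − H X b‖ ≤ B♭·t` whenever
# `‖X_t‖ ≤ t`, at every admissible family of the record's tori — k0-s1-w3's port `KernelRowsAt` ((2.151)₁,₂ kernel rows of `flatH` + the (162) row sum, same distance)

Cell `pub-ymgap`, width seat `pub-ymgap-k0-s1-w4` g0′ (FILE 10; reading (R1′)).  `--kind proof --supports stmt-QuantumFields-20541 --as helper`; count-neutral.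
[15] = [Balaban1985Variational]; [B6] = [Balaban1984PropagatorsII].

WHY.  k0-s1-w2 g4's chart-socket edition of the S4b capstone (`…SectFWSlotAtRecordSocket`) takes the right inverse `H` only through its two (46) rows `hHB` (`B₀`), `hHgrad`
(`B₁`) — no right-inverse property.  On the ♭ road the `H` of record is the flat `H_V` composed with the block rescaling `(Lʲη)⁻¹` (so that `Qlin♭∘H = id`, `Qlin♭ =
(Lʲη)•Q_V`); its rows in the socket's UNWEIGHTED-datum shape follow from the kernel rows (2.151)₁,₂ of `flatH` (`HKernelRows` k1, k2) and the (162) row sum WITH its datum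
weight `L^{k−j(c)} = (L^{j(c)}η)⁻¹` (`RowSum162`), both over the same distance `dBI` of k0-s1-w3's `KernelRowsAt` (`K0FlatPortKernelRowsP.kernelRowsAt_of_adm22`).
With this file, FILE 8 (`h₀`), FILE 9 (`q₀`, `q` for `Qlin♭`) and p616957 (`O₁`), every displayed letter of the socket on the ♭ road except `θ₀` has a supplier.

WHAT IS PROVED (sorry-free; no definition; axioms standard).
* §1 (generic `P`, `D`, abstract rows) ★ `rescaledRows_of_kernelRows` — `HKernelRows P k D dBI w flatH C δ` + `RowSum162 P k D dBI w δ B₃` + `dBI ≥ 0` ⇒ for every normed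
  `ℂ`-space fibre, every `ν` with `|ν_t| ≤ L^{k−j(t)}` and every `H` with kernel `Σ_t (ν_t·flatH e_t b)•X_t`: the two rows above with `B♭ = C·B₃`.
* §2 ★★★ `rescaledRows_of_adm22_T4` — for every `F : T4Family`: `Mh₀, R₀, B♭ ≥ 0` such that at every admissible family in the standing range and every such `H`:
  `hHB` and `hHgrad` of p612123 ∕ the socket, verbatim (`0 ≤ t → (∀ i, ‖X i‖ ≤ t) → …`).
HONEST SCOPE.  Bookkeeping over k0-s1-w3's port; flat∕♭ `H` only; nothing of Bałaban's analysis asserted; `stub_prop8StepCoP13` ∕ K0⁷ NOT closed; N07 NOT discharged; counts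
unmoved (28∕28 · 5∕27); R4 closes the conditional finite-𝕋⁴ rung `BalabanLadder.UV` only, never the summit; the YM mass gap (Clay) is NOT proved by any of this; nothing continuum
∕ ℝ⁴ ∕ OS.  No `sorry`, no `def`, no `instance`, no `notation`.
References: [15] (45)–(46) p.285, (152) p.301, (157) p.302, (161)–(162) p.303; [B6] (2.35) p.228, Cor. 2.8 (2.150)–(2.151) p.249; [Balaban1987RG1] (0.1) p.251.
-/

set_option autoImplicit false

noncomputable section

open scoped BigOperators

namespace Summit.QuantumFields.YangMills.Theorems.K0Stub1FlatHRescaledRowsAtRecord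

open Literature.MathematicalPhysics.QuantumFieldTheory.Balaban1983to89
open Literature.MathematicalPhysics.QuantumFieldTheory.Balaban1983to89.T4Continuum (T4Family)
open B6SectADomainsV1 (Domains)
open B6SectAOperatorsV1 (BondIdx)
open B6GlobalChartV1 (PV)
open Summit.QuantumFields.YangMills.Theorems.FlatCubeOpsText (Adm22 distBI)
open Summit.QuantumFields.YangMills.Theorems.K0FlatCubeOpsTextP (IsLevWeight flatH HKernelRows RowSum162 KernelRowsAt)
open Summit.QuantumFields.YangMills.Theorems.HalvingQuarterCubeSeq (distBI_nonneg)
open Summit.QuantumFields.YangMills.Theorems.K0FlatPortKernelRowsP (kernelRowsAt_of_adm22)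

/-! ## §1  The rows of a rescaled kernel map from the kernel rows of `flatH` and the (162) row sum -/

section Generic

variable {P : Params} {k : ℕ} {D : Domains P}

/-- `e^{−δd} ≤ e^{−(δ/2)d}·(d + 1)` for `d ≥ 0`, `δ ≥ 0`. [folklore] -/
theorem exp_le_exp_half_mul_succ {δ d : ℝ} (hδ : 0 ≤ δ) (hd : 0 ≤ d) : Real.exp (-(δ * d)) ≤ Real.exp (-(δ / 2 * d)) * (d + 1) := by
  have h1 : Real.exp (-(δ * d)) ≤ Real.exp (-(δ / 2 * d)) := Real.exp_le_exp.2 (by nlinarith)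
  have h2 : Real.exp (-(δ / 2 * d)) ≤ Real.exp (-(δ / 2 * d)) * (d + 1) := le_mul_of_one_le_right (Real.exp_pos _).le (by linarith)
  exact h1.trans h2

/-- ★ **THE TWO (46) ROWS OF A RESCALED KERNEL MAP** (abstract rows): from `HKernelRows P k D dBI w (flatH P k D) C δ` (k1: `|(He_c)(b)| ≤ Ce^{−δd}`; k2:
`w₁(b)Lᵏ|(He_c)(b+ν) − (He_c)(b)| ≤ Ce^{−δd}`), `RowSum162 P k D dBI w δ B₃` (`w₁(b)Σ_c e^{−½δd}(d+1)L^{k−j(c)} ≤ B₃`) and `dBI ≥ 0`: for every `ν` with `|ν_t| ≤ L^{k−j(t)}` and every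
`H` with kernel `(H X)(b) = Σ_t (ν_t·(flatH e_t)(b))•X_t` on a normed `ℂ`-space: `‖X_t‖ ≤ s` ⇒ `w 1 b·‖H X b‖ ≤ C·B₃·s` and `w 2 b·Lᵏ·‖H X (b+ν′) − H X b‖ ≤ C·B₃·s`
(`w₂ = w₁·w₁`: one weight feeds k2, the other the (162) row sum). [cite: Balaban1985Variational, (46) p.285, (161)-(162) p.303; Balaban1984PropagatorsII, Cor. 2.8 (2.151) p.249] -/
theorem rescaledRows_of_kernelRows {dBI : PBond P 0 → BondIdx D → ℝ} {w : ℕ → PBond P 0 → ℝ} (hw : IsLevWeight P k D w)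
    {C δ B₃ : ℝ} (hC : 0 ≤ C) (hδ : 0 ≤ δ) (hd0 : ∀ b c, 0 ≤ dBI b c)
    (hK : HKernelRows P k D dBI w (flatH P k D) C δ) (h162 : RowSum162 P k D dBI w δ B₃)
    {𝔸 : Type*} [SeminormedAddCommGroup 𝔸] [NormedSpace ℂ 𝔸]
    (ν : BondIdx D → ℝ) (hν : ∀ t : BondIdx D, |ν t| ≤ (P.L : ℝ) ^ (k - (t.1.1 : ℕ)))
    (H : (BondIdx D → 𝔸) → (PBond P 0 → 𝔸))
    (hH : ∀ (X : BondIdx D → 𝔸) (b : PBond P 0), H X b = ∑ t, ((ν t * flatH P k D (Pi.single t 1) b : ℝ) : ℂ) • X t)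
    (X : BondIdx D → 𝔸) (s : ℝ) (hs : 0 ≤ s) (hX : ∀ t, ‖X t‖ ≤ s) (b : PBond P 0) :
    w 1 b * ‖H X b‖ ≤ C * B₃ * s ∧
      ∀ ν' : Fin P.d, w 2 b * (P.L : ℝ) ^ k * ‖H X ⟨b.src.shift ν', b.dir⟩ - H X b‖ ≤ C * B₃ * s := by
  classical
  have hL0 : (0 : ℝ) < (P.L : ℝ) := by exact_mod_cast P.L_pos
  have hw1 : 0 ≤ w 1 b := by rw [hw 1 b]; positivity
  have hw2 : w 2 b = w 1 b * w 1 b := by rw [hw 2 b, hw 1 b, pow_one, pow_two]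
  -- the kernel rows at the indicator `e_t`
  have hk : ∀ t : BondIdx D, |flatH P k D (Pi.single t 1) b| ≤ C * Real.exp (-(δ * dBI b t)) ∧
      ∀ ν' : Fin P.d, w 1 b * (P.L : ℝ) ^ k * |flatH P k D (Pi.single t 1) ⟨b.src.shift ν', b.dir⟩ - flatH P k D (Pi.single t 1) b| ≤ C * Real.exp (-(δ * dBI b t)) := by
    intro t
    have h := hK t (Pi.single t 1) (Pi.single_eq_same t 1) (fun c' hc' => Pi.single_eq_of_ne hc' 1) b
    exact ⟨h.1, h.2.1⟩
  -- the weighted row sum `w₁(b)·Σ_t Ce^{−δd}·L^{k−j(t)} ≤ C·B₃`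
  have hrow : w 1 b * ∑ t : BondIdx D, C * Real.exp (-(δ * dBI b t)) * (P.L : ℝ) ^ (k - (t.1.1 : ℕ)) ≤ C * B₃ := by
    have h1 : ∀ t : BondIdx D, C * Real.exp (-(δ * dBI b t)) * (P.L : ℝ) ^ (k - (t.1.1 : ℕ)) ≤
        C * (Real.exp (-(δ / 2 * dBI b t)) * (dBI b t + 1) * (P.L : ℝ) ^ (k - (t.1.1 : ℕ))) := fun t => by
      rw [mul_assoc]
      exact mul_le_mul_of_nonneg_left (mul_le_mul_of_nonneg_right (exp_le_exp_half_mul_succ hδ (hd0 b t)) (by positivity)) hC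
    calc w 1 b * ∑ t : BondIdx D, C * Real.exp (-(δ * dBI b t)) * (P.L : ℝ) ^ (k - (t.1.1 : ℕ))
        ≤ w 1 b * ∑ t : BondIdx D, C * (Real.exp (-(δ / 2 * dBI b t)) * (dBI b t + 1) * (P.L : ℝ) ^ (k - (t.1.1 : ℕ))) :=
          mul_le_mul_of_nonneg_left (Finset.sum_le_sum fun t _ => h1 t) hw1
      _ = C * (w 1 b * ∑ t : BondIdx D, Real.exp (-(δ / 2 * dBI b t)) * (dBI b t + 1) * (P.L : ℝ) ^ (k - (t.1.1 : ℕ))) := by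
          rw [← Finset.mul_sum]; ring
      _ ≤ C * B₃ := mul_le_mul_of_nonneg_left (h162 b) hC
  -- `|ν_t|·‖X_t‖ ≤ L^{k−j(t)}·s`
  have hνX : ∀ t, |ν t| * ‖X t‖ ≤ (P.L : ℝ) ^ (k - (t.1.1 : ℕ)) * s := fun t =>
    mul_le_mul (hν t) (hX t) (norm_nonneg _) (by positivity)
  refine ⟨?_, fun ν' => ?_⟩
  · -- the sup row
    calc w 1 b * ‖H X b‖ = w 1 b * ‖∑ t, ((ν t * flatH P k D (Pi.single t 1) b : ℝ) : ℂ) • X t‖ := by rw [hH]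
      _ ≤ w 1 b * ∑ t, |flatH P k D (Pi.single t 1) b| * (|ν t| * ‖X t‖) := by
          refine mul_le_mul_of_nonneg_left ((norm_sum_le _ _).trans (Finset.sum_le_sum fun t _ => ?_)) hw1
          rw [norm_smul, Complex.norm_real, Real.norm_eq_abs, abs_mul]; exact le_of_eq (by ring)
      _ ≤ w 1 b * ∑ t, C * Real.exp (-(δ * dBI b t)) * ((P.L : ℝ) ^ (k - (t.1.1 : ℕ)) * s) :=
          mul_le_mul_of_nonneg_left (Finset.sum_le_sum fun t _ => mul_le_mul (hk t).1 (hνX t) (by positivity) (by positivity)) hw1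
      _ = (w 1 b * ∑ t, C * Real.exp (-(δ * dBI b t)) * (P.L : ℝ) ^ (k - (t.1.1 : ℕ))) * s := by
          rw [mul_assoc, Finset.sum_mul]; exact congrArg _ (Finset.sum_congr rfl fun t _ => by ring)
      _ ≤ C * B₃ * s := mul_le_mul_of_nonneg_right hrow hs
  · -- the gradient row (`w₂ = w₁·w₁`: one weight for the kernel row k2, one for the (162) row sum)
    have hdiff : H X ⟨b.src.shift ν', b.dir⟩ - H X b =
        ∑ t, ((ν t * (flatH P k D (Pi.single t 1) ⟨b.src.shift ν', b.dir⟩ - flatH P k D (Pi.single t 1) b) : ℝ) : ℂ) • X t := by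
      rw [hH, hH, ← Finset.sum_sub_distrib]
      exact Finset.sum_congr rfl fun t _ => by rw [← sub_smul]; push_cast; ring_nf
    calc w 2 b * (P.L : ℝ) ^ k * ‖H X ⟨b.src.shift ν', b.dir⟩ - H X b‖
        = w 1 b * (w 1 b * (P.L : ℝ) ^ k * ‖H X ⟨b.src.shift ν', b.dir⟩ - H X b‖) := by rw [hw2]; ring
      _ ≤ w 1 b * (w 1 b * (P.L : ℝ) ^ k * ∑ t, |flatH P k D (Pi.single t 1) ⟨b.src.shift ν', b.dir⟩ - flatH P k D (Pi.single t 1) b| * (|ν t| * ‖X t‖)) := by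
          rw [hdiff]
          refine mul_le_mul_of_nonneg_left (mul_le_mul_of_nonneg_left ((norm_sum_le _ _).trans (Finset.sum_le_sum fun t _ => ?_)) (by positivity)) hw1
          rw [norm_smul, Complex.norm_real, Real.norm_eq_abs, abs_mul]; exact le_of_eq (by ring)
      _ = w 1 b * ∑ t, (w 1 b * (P.L : ℝ) ^ k * |flatH P k D (Pi.single t 1) ⟨b.src.shift ν', b.dir⟩ - flatH P k D (Pi.single t 1) b|) * (|ν t| * ‖X t‖) := by
          rw [Finset.mul_sum]; exact congrArg _ (Finset.sum_congr rfl fun t _ => by ring)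
      _ ≤ w 1 b * ∑ t, C * Real.exp (-(δ * dBI b t)) * ((P.L : ℝ) ^ (k - (t.1.1 : ℕ)) * s) :=
          mul_le_mul_of_nonneg_left (Finset.sum_le_sum fun t _ => mul_le_mul ((hk t).2 ν') (hνX t) (by positivity) (by positivity)) hw1
      _ = (w 1 b * ∑ t, C * Real.exp (-(δ * dBI b t)) * (P.L : ℝ) ^ (k - (t.1.1 : ℕ))) * s := by
          rw [mul_assoc, Finset.sum_mul]; exact congrArg _ (Finset.sum_congr rfl fun t _ => by ring)
      _ ≤ C * B₃ * s := mul_le_mul_of_nonneg_right hrow hs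

end Generic

/-! ## §2  At the record: `hHB`, `hHgrad` of p612123 ∕ the socket for every rescaled flat right inverse -/

/-- ★★★ **THE SOCKET's `hHB`, `hHgrad` FOR THE FLAT ∕ ♭-RESCALED RIGHT INVERSE AT THE RECORD** — for every `F : T4Family` there are `Mh₀, R₀` and ONE constant `B♭ ≥ 0` such
that at every admissible family of the record's tori in the standing range (`1 ≤ K − n`, `K − n + 1 ≤ m + K`, `M_h = L^{a′} ≥ M_h⁰`, `R ≥ R₀`, `a′ + 3 ≤ m + n`, `D.k = K − n`,
`Adm22 D R (L·M_h)`), the (152) weights, every normed `ℂ`-space fibre, every rescaling `ν` with `|ν_t| ≤ (L^{j(t)}η)⁻¹` (`η = L^{−(K−n)}`) and every map `H` with the kernel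
`(H X)(b) = Σ_t (ν_t·(flatH e_t)(b))•X_t` (p598821's `H_V`: `ν ≡ 1`; the ♭ right inverse `H_V∘((Lʲη)⁻¹•·)` of `Qlin♭ = (Lʲη)•Q_V`: `ν_t = (L^{j(t)}η)⁻¹`):
`0 ≤ t → (∀ i, ‖X i‖ ≤ t) → ∀ b, w 1 b·‖H X b‖ ≤ B♭·t` and `… → ∀ b ν′, w 2 b·L^{K−n}·‖H X ⟨b.src.shift ν′, b.dir⟩ − H X b‖ ≤ B♭·t` — p612123's ∕ the socket's `hHB`, `hHgrad`
verbatim (`B₀ = B₁ = B♭`).  From k0-s1-w3's `KernelRowsAt` at every admissible family (`K0FlatPortKernelRowsP.kernelRowsAt_of_adm22`, `d + 1 = 4`) by §1.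
[cite: Balaban1985Variational, (45)-(46) p.285, (161)-(162) p.303; Balaban1984PropagatorsII, Cor. 2.8 (2.150)-(2.151) p.249; Balaban1987RG1, (0.1) p.251] -/
theorem rescaledRows_of_adm22_T4 (F : T4Family) :
    ∃ (Mh₀ R₀ : ℕ) (Bf : ℝ), 0 ≤ Bf ∧
    ∀ (n K : ℕ) (_ : 1 ≤ K - n) (_ : K - n + 1 ≤ F.m + K) {Mh R a' : ℕ} (_ : Mh = F.L ^ a') (_ : Mh₀ ≤ Mh) (_ : R₀ ≤ R)
      (_ : a' + 3 ≤ F.m + n) (D : Domains (F.P K)) (_ : D.k = K - n) (_ : Adm22 D R (F.L * Mh))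
      (w : ℕ → PBond (F.P K) 0 → ℝ) (_ : IsLevWeight (F.P K) (K - n) D w)
      {𝔸 : Type} [SeminormedAddCommGroup 𝔸] [NormedSpace ℂ 𝔸]
      (ν : BondIdx D → ℝ) (_ : ∀ t : BondIdx D, |ν t| ≤ (((F.P K).L : ℝ) ^ (t.1.1 : ℕ) * ((((F.P K).L : ℝ))⁻¹) ^ (K - n))⁻¹)
      (H : (BondIdx D → 𝔸) → (PBond (F.P K) 0 → 𝔸))
      (_ : ∀ (X : BondIdx D → 𝔸) (b : PBond (F.P K) 0), H X b = ∑ t, ((ν t * flatH (F.P K) (K - n) D (Pi.single t 1) b : ℝ) : ℂ) • X t),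
      (∀ (X : BondIdx D → 𝔸) (t : ℝ), 0 ≤ t → (∀ i, ‖X i‖ ≤ t) → ∀ b, w 1 b * ‖H X b‖ ≤ Bf * t) ∧
      (∀ (X : BondIdx D → 𝔸) (t : ℝ), 0 ≤ t → (∀ i, ‖X i‖ ≤ t) →
        ∀ (b : PBond (F.P K) 0) (ν' : Fin (F.P K).d), w 2 b * ((F.P K).L : ℝ) ^ (K - n) * ‖H X ⟨b.src.shift ν', b.dir⟩ - H X b‖ ≤ Bf * t) := by
  obtain ⟨L, hL, h11, m, hm⟩ := F
  obtain ⟨ℓ, rfl⟩ : ∃ ℓ, L = ℓ + 1 := ⟨L - 1, by omega⟩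
  have hℓ : 4 ≤ ℓ := by omega
  obtain ⟨Mh₀, R₀, C, δ₀, B₃, CG, hC, hδ₀, hB₃, -, hmain⟩ := kernelRowsAt_of_adm22 3 ℓ K0FlatCubeOpsTextP.hd4 hL hℓ
  refine ⟨Mh₀, R₀, C * B₃, mul_nonneg hC hB₃.le, ?_⟩
  intro n K hk1 hk' Mh R a' hMha hMh hR hsize D hDk hAdm w hw 𝔸 _ _ ν hν H hH
  obtain ⟨⟨dBI, hdist, h162, hK⟩, -⟩ := hmain m n K hk1 hk' hMha hMh hR hsize D hDk hAdm w hw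
  have hd0 : ∀ b c, 0 ≤ dBI b c := fun b c => (distBI_nonneg D b c).trans (hdist b c)
  -- `(L^{j}·(L⁻¹)^{K−n})⁻¹ = L^{(K−n)−j}` on the levels `j ≤ K − n` that occur
  have hL0 : (0 : ℝ) < ((PV 3 ℓ m K K0FlatCubeOpsTextP.hd4 hL).L : ℝ) := by exact_mod_cast (PV 3 ℓ m K K0FlatCubeOpsTextP.hd4 hL).L_pos
  have hν' : ∀ t : BondIdx D, |ν t| ≤ ((PV 3 ℓ m K K0FlatCubeOpsTextP.hd4 hL).L : ℝ) ^ (K - n - (t.1.1 : ℕ)) := by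
    intro t
    refine (hν t).trans (le_of_eq ?_)
    have hj : (t.1.1 : ℕ) ≤ K - n := by have := t.1.1.2; omega
    rw [inv_pow, ← div_eq_mul_inv, inv_div]
    show ((PV 3 ℓ m K K0FlatCubeOpsTextP.hd4 hL).L : ℝ) ^ (K - n) / ((PV 3 ℓ m K K0FlatCubeOpsTextP.hd4 hL).L : ℝ) ^ (t.1.1 : ℕ) = _
    rw [div_eq_iff (pow_ne_zero _ hL0.ne'), ← pow_add, Nat.sub_add_cancel hj]
  exact ⟨fun X t ht hX b => (rescaledRows_of_kernelRows hw hC hδ₀.le hd0 hK h162 ν hν' H hH X t ht hX b).1,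
    fun X t ht hX b ν'' => (rescaledRows_of_kernelRows hw hC hδ₀.le hd0 hK h162 ν hν' H hH X t ht hX b).2 ν''⟩


end Summit.QuantumFields.YangMills.Theorems.K0Stub1FlatHRescaledRowsAtRecord

end
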